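import Summits.Ventures.HSemireg.WedgePointPairPowers

/-!
# Venture HSemireg — BASIS-FREE wedge ranks: the rank profile of `θ ↦ θ ∧ x` is a `GL(V)`-invariant; THEOREM T coordinate-free

HONEST FRAMING. Part of the Lean index of the computation cell `pub-hsemireg` (seat p10 gen 6, Sunday typer «UNIFORM-IN-n»).
Finite-dimensional EXTERIOR ALGEBRA over a field ONLY: no variety, no cohomology theory, no sheaf, no Ext group and no
semiregularity map is constructed here; nothing here says that HC / HC_CM / HC_AV holds; no Literature fact is declared or used.
Custodian versions cited: theory/FORMULA-N.md PART A §2.1–§2.2 (th-6: «pure classes `vol(K)·Ω`», «two pure classes are TRANSVERSE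
if `K₁ ∩ K₂ = 0`», THEOREM T «pure exterior algebra; the complex structure enters only through `dim V = n`»), PART B §A.3 (th-7).

WHY THIS FILE.  Every wedge-model file of the cell (`WedgeModel*.lean`, `WedgePair*.lean`, `WedgeBox*.lean`, `WedgePointPairPowers*`,
…) works in the COORDINATE model `⋀(I → K)` with Mathlib's monomial basis of `Pi.basisFun`: th-6's / th-7's first step «choose a
basis of `N_X` adapted to `K₁ ⊕ K₂`» is part of the quoted dictionary.  THIS FILE proves that step is harmless, once and for all:
* §1 TRANSPORT (any `K`-modules `V`, `W`): a linear equivalence `g : V ≃ W` induces the algebra isomorphism `mapEquiv g : ⋀V ≃ ⋀W`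
  (`ExteriorAlgebra.map` both ways); it sends `ιMulti v ↦ ιMulti (g ∘ v)` (`mapEquiv_ιMulti`), the monomials of a basis `β` to those
  of `β.map g` (`mapEquiv_basis`), `⋀^k V` ONTO `⋀^k W` (`map_exteriorPower`), and the range of `θ ↦ θ ∧ x` on `⋀^k V` onto the range of
  `θ ↦ θ ∧ (mapEquiv g x)` (`map_range_wedgeV`), kernels onto kernels (`map_ker_wedgeV`); hence **`finrank_range_wedgeV_mapEquiv`** /
  `finrank_ker_wedgeV_mapEquiv`: **the wedge-rank profile `k ↦ rank(θ ↦ θ ∧ x ∣ ⋀^k)` and the kernel subspaces are invariant under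
  every linear equivalence** (`GL`-invariance of all the cell's class-side numbers, C4's NAME included).
* §2 TO THE MODEL: for ANY basis `β` of ANY `V` (indexed by a finite linear order `I`), `mapEquiv β.equivFun` sends the `β`-monomial
  `β_{s}` (`= β_{i₁} ∧ ⋯ ∧ β_{i_k}`, Mathlib's `β.ExteriorAlgebra s`) to the model monomial `Wedge.B K I s` (`mapEquiv_equivFun_basis`),
  so **`finrank_range_wedgeV_eq_model`**: the wedge ranks of `x ∈ ⋀V` are the model wedge ranks (`Wedge.Kunneth.wedge`) of its
  coordinate expression — every kernel theorem of the coordinate model holds verbatim in any basis.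
* §3 **THEOREM T, COORDINATE-FREE** (`theoremT_subspaces`): for ANY `K`-space `V`, ANY two COMPLEMENTARY subspaces `K₁ ⊕ K₂ = V`
  of dimension `n ≥ 1` with ANY bases `b₁`, `b₂`, and `a, c ≠ 0`, the transverse pair
  `f = a·(b₁0 ∧ ⋯ ∧ b₁(n−1)) + c·(b₂0 ∧ ⋯ ∧ b₂(n−1))` (`= a·vol(K₁) + c·vol(K₂)`) has
  **`rank(θ ↦ θ ∧ f ∣ ⋀^k V) = 2C(n,k) − [k=0] − [k=n]`** for every `k ≤ n` (and `0` for `k > n`, `theoremT_subspaces_eq_zero`) —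
  th-6's THEOREM T exactly as worded in §2.2 (`N_X = K₁ ⊕ K₂`, `dim K_i = n`), reduced to `WedgePairRank.finrank_range_wedgeMap_pointPair`
  by the adapted basis `β = (b₁, b₂)` (`basisOfIsCompl`, `basisOfIsCompl_vol₁/₂`: its first-half / second-half monomials ARE
  `vol(K₁)`, `vol(K₂)`).  Another basis of `K_j` rescales `vol(K_j)` by a non-zero determinant, absorbed in `a`, `c` (not re-proved).
NOT HERE (honest): anything Ext-side; the degenerate-pair (T′) and box versions transport the same way (one `mapEquiv` each) and are
left to the files that own those models.  Namespace `Summit.Ventures.HSemireg.Wedge.BasisFree` (new); new names only.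
-/

open Module Set Set.powersetCard

namespace Summit.Ventures.HSemireg.Wedge.BasisFree

open Summit.Ventures.HSemireg.Wedge Summit.Ventures.HSemireg.Wedge.Kunneth

variable (K : Type*) [Field K]
variable {V W : Type*} [AddCommGroup V] [Module K V] [AddCommGroup W] [Module K W]

/-! ## §1. Transport along a linear equivalence -/

/-- the algebra isomorphism `⋀V ≃ ⋀W` induced by a linear equivalence `g : V ≃ W` (`ExteriorAlgebra.map g`, inverse
`ExteriorAlgebra.map g⁻¹`, by functoriality). -/
noncomputable def mapEquiv (g : V ≃ₗ[K] W) : ExteriorAlgebra K V ≃ₐ[K] ExteriorAlgebra K W :=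
  AlgEquiv.ofAlgHom (ExteriorAlgebra.map g.toLinearMap) (ExteriorAlgebra.map g.symm.toLinearMap)
    (by rw [ExteriorAlgebra.map_comp_map, LinearEquiv.comp_symm, ExteriorAlgebra.map_id])
    (by rw [ExteriorAlgebra.map_comp_map, LinearEquiv.symm_comp, ExteriorAlgebra.map_id])

/-- `mapEquiv g` is `ExteriorAlgebra.map g` on elements. -/
lemma mapEquiv_apply (g : V ≃ₗ[K] W) (x : ExteriorAlgebra K V) : mapEquiv K g x = ExteriorAlgebra.map g.toLinearMap x := rfl

/-- `mapEquiv g (v₁ ∧ ⋯ ∧ v_n) = g v₁ ∧ ⋯ ∧ g v_n`. -/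
lemma mapEquiv_ιMulti (g : V ≃ₗ[K] W) {n : ℕ} (v : Fin n → V) :
    mapEquiv K g (ExteriorAlgebra.ιMulti K n v) = ExteriorAlgebra.ιMulti K n (g ∘ v) := by
  rw [mapEquiv_apply, ExteriorAlgebra.map_apply_ιMulti]
  rfl

/-- `mapEquiv g` sends the monomials of a basis `β` of `V` to the monomials of the transported basis `β.map g` of `W`. -/
lemma mapEquiv_basis {I : Type*} [LinearOrder I] (g : V ≃ₗ[K] W) (β : Basis I K V) (s : Finset I) :
    mapEquiv K g (β.ExteriorAlgebra s) = (β.map g).ExteriorAlgebra s := by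
  rw [ExteriorAlgebra.basis_apply, ExteriorAlgebra.basis_apply]
  show mapEquiv K g (ExteriorAlgebra.ιMulti K _ _) = ExteriorAlgebra.ιMulti K _ _
  rw [mapEquiv_ιMulti]
  refine congrArg _ (funext fun i => ?_)
  simp only [Function.comp_apply, Basis.map_apply]

/-- `mapEquiv g` maps `⋀^k V` ONTO `⋀^k W`. -/
lemma map_exteriorPower (g : V ≃ₗ[K] W) (k : ℕ) :
    Submodule.map (mapEquiv K g).toLinearMap (⋀[K]^k V) = ⋀[K]^k W := by
  apply le_antisymm
  · rw [← ExteriorAlgebra.ιMulti_span_fixedDegree K k (M := V), Submodule.map_span, Submodule.span_le]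
    rintro _ ⟨_, ⟨v, rfl⟩, rfl⟩
    rw [SetLike.mem_coe, AlgEquiv.toLinearMap_apply, mapEquiv_ιMulti]
    exact ExteriorAlgebra.ιMulti_range K k ⟨_, rfl⟩
  · rw [← ExteriorAlgebra.ιMulti_span_fixedDegree K k (M := W), Submodule.span_le]
    rintro _ ⟨w, rfl⟩
    rw [SetLike.mem_coe, Submodule.mem_map]
    refine ⟨ExteriorAlgebra.ιMulti K k (g.symm ∘ w), ExteriorAlgebra.ιMulti_range K k ⟨_, rfl⟩, ?_⟩
    rw [AlgEquiv.toLinearMap_apply, mapEquiv_ιMulti]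
    congr 1
    funext i
    exact g.apply_symm_apply (w i)

/-- the wedge map `θ ↦ θ ∧ x` on `⋀^k V` for an ARBITRARY module `V` (for `V = (I → K)` this is `Wedge.Kunneth.wedge K I k x`
definitionally, `wedgeV_eq_wedge`). -/
noncomputable def wedgeV (k : ℕ) (x : ExteriorAlgebra K V) : (⋀[K]^k V) →ₗ[K] ExteriorAlgebra K V :=
  (LinearMap.mulRight K x) ∘ₗ (⋀[K]^k V).subtype

/-- in the coordinate model `wedgeV` is the cell's `wedge`. -/
lemma wedgeV_eq_wedge {I : Type*} [LinearOrder I] [Fintype I] (k : ℕ) (x : HT K I) : wedgeV K k x = wedge K I k x := rfl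

/-- the range of `θ ↦ θ ∧ x` on `⋀^k` is the image of `⋀^k` under right multiplication by `x`. -/
lemma range_wedgeV (k : ℕ) (x : ExteriorAlgebra K V) :
    LinearMap.range (wedgeV K k x) = (⋀[K]^k V).map (LinearMap.mulRight K x) := by
  rw [wedgeV, LinearMap.range_comp, Submodule.range_subtype]

/-- transport of wedge ranges: `mapEquiv g (range(θ ↦ θ ∧ x ∣ ⋀^k V)) = range(θ ↦ θ ∧ mapEquiv g x ∣ ⋀^k W)`. -/
lemma map_range_wedgeV (g : V ≃ₗ[K] W) (k : ℕ) (x : ExteriorAlgebra K V) :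
    (LinearMap.range (wedgeV K k x)).map (mapEquiv K g).toLinearMap = LinearMap.range (wedgeV K k (mapEquiv K g x)) := by
  have h : (mapEquiv K g).toLinearMap ∘ₗ LinearMap.mulRight K x =
      LinearMap.mulRight K (mapEquiv K g x) ∘ₗ (mapEquiv K g).toLinearMap :=
    LinearMap.ext fun θ => show mapEquiv K g (θ * x) = mapEquiv K g θ * mapEquiv K g x from map_mul _ _ _
  rw [range_wedgeV, range_wedgeV, ← map_exteriorPower K g k, ← Submodule.map_comp, ← Submodule.map_comp, h]

/-- **RANK INVARIANCE: the wedge-rank profile `k ↦ rank(θ ↦ θ ∧ x ∣ ⋀^k)` is invariant under every linear equivalence**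
(`rank` of `mapEquiv g x` in `⋀W` = `rank` of `x` in `⋀V`, every `k`). -/
theorem finrank_range_wedgeV_mapEquiv (g : V ≃ₗ[K] W) (k : ℕ) (x : ExteriorAlgebra K V) :
    finrank K (LinearMap.range (wedgeV K k (mapEquiv K g x))) = finrank K (LinearMap.range (wedgeV K k x)) := by
  rw [← map_range_wedgeV]
  exact (Submodule.equivMapOfInjective _ (fun a b h => (mapEquiv K g).injective h) _).finrank_eq.symm

/-- transport of KERNELS: `mapEquiv g` carries `ker(θ ↦ θ ∧ x ∣ ⋀^k V)` (as a subspace of `⋀V`) onto `ker(θ ↦ θ ∧ mapEquiv g x ∣ ⋀^k W)` —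
so kernel SUBSPACES (STRUCTURE C4's NAME, `WedgeBoxKernelSpan` / the `n`-fold analogue) transport along with the ranks. -/
theorem map_ker_wedgeV (g : V ≃ₗ[K] W) (k : ℕ) (x : ExteriorAlgebra K V) :
    ((LinearMap.ker (wedgeV K k x)).map (⋀[K]^k V).subtype).map (mapEquiv K g).toLinearMap =
      (LinearMap.ker (wedgeV K k (mapEquiv K g x))).map (⋀[K]^k W).subtype := by
  apply le_antisymm
  · rintro _ ⟨θ, ⟨θ', hθ', rfl⟩, rfl⟩
    rw [SetLike.mem_coe, LinearMap.mem_ker] at hθ'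
    have hmem : mapEquiv K g (θ' : ExteriorAlgebra K V) ∈ ⋀[K]^k W := by
      rw [← map_exteriorPower K g k]; exact ⟨θ', θ'.2, rfl⟩
    refine ⟨⟨_, hmem⟩, ?_, rfl⟩
    rw [SetLike.mem_coe, LinearMap.mem_ker]
    show mapEquiv K g (θ' : ExteriorAlgebra K V) * mapEquiv K g x = 0
    rw [← map_mul, show (θ' : ExteriorAlgebra K V) * x = 0 from hθ', map_zero]
  · rintro _ ⟨η, hη, rfl⟩
    rw [SetLike.mem_coe, LinearMap.mem_ker] at hη
    have hη' : (η : ExteriorAlgebra K W) * mapEquiv K g x = 0 := hη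
    have hmem : (mapEquiv K g).symm (η : ExteriorAlgebra K W) ∈ ⋀[K]^k V := by
      have h2 : (η : ExteriorAlgebra K W) ∈ Submodule.map (mapEquiv K g).toLinearMap (⋀[K]^k V) := by
        rw [map_exteriorPower K g k]; exact η.2
      obtain ⟨θ, hθ, e⟩ := h2
      rw [← e, AlgEquiv.toLinearMap_apply, AlgEquiv.symm_apply_apply]
      exact hθ
    refine ⟨(mapEquiv K g).symm η, ⟨⟨_, hmem⟩, ?_, rfl⟩, ?_⟩
    · rw [SetLike.mem_coe, LinearMap.mem_ker]
      show (mapEquiv K g).symm (η : ExteriorAlgebra K W) * x = 0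
      apply (mapEquiv K g).injective
      rw [map_mul, AlgEquiv.apply_symm_apply, map_zero, hη']
    · rw [AlgEquiv.toLinearMap_apply, AlgEquiv.apply_symm_apply]
      rfl

/-- hence **kernel dimensions are invariant too**: `dim ker(θ ↦ θ ∧ mapEquiv g x ∣ ⋀^k W) = dim ker(θ ↦ θ ∧ x ∣ ⋀^k V)`. -/
theorem finrank_ker_wedgeV_mapEquiv (g : V ≃ₗ[K] W) (k : ℕ) (x : ExteriorAlgebra K V) :
    finrank K (LinearMap.ker (wedgeV K k (mapEquiv K g x))) = finrank K (LinearMap.ker (wedgeV K k x)) := by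
  rw [← Submodule.finrank_map_subtype_eq (⋀[K]^k W) (LinearMap.ker (wedgeV K k (mapEquiv K g x))), ← map_ker_wedgeV,
    ← Submodule.finrank_map_subtype_eq (⋀[K]^k V) (LinearMap.ker (wedgeV K k x))]
  exact ((Submodule.equivMapOfInjective _ (fun a b h => (mapEquiv K g).injective h) _).finrank_eq).symm

/-! ## §2. To the coordinate model: any basis `β` of any `V` -/

section Model

variable {I : Type*} [LinearOrder I] [Fintype I]

/-- the coordinates of a basis in itself: `β.map β.equivFun` is the standard basis `Pi.basisFun` (`= Wedge.b K I`). -/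
lemma map_equivFun (β : Basis I K V) : β.map β.equivFun = b K I := by
  classical
  apply Basis.eq_of_apply_eq
  intro i
  rw [Basis.map_apply, b, Pi.basisFun_apply]
  funext j
  rw [Basis.equivFun_self, Pi.single_apply]
  by_cases h : i = j
  · rw [if_pos h, if_pos h.symm]
  · rw [if_neg h, if_neg (Ne.symm h)]

/-- **TO THE MODEL: `mapEquiv β.equivFun (β_{s}) = B K I s`** — the coordinate isomorphism of a basis `β` sends the `β`-monomials
`β_{i₁} ∧ ⋯ ∧ β_{i_k}` to the model monomials of `WedgeModel.lean`. -/
theorem mapEquiv_equivFun_basis (β : Basis I K V) (s : Finset I) :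
    mapEquiv K β.equivFun (β.ExteriorAlgebra s) = B K I s := by
  rw [mapEquiv_basis, map_equivFun]
  rfl

omit [LinearOrder I] in
/-- **BASIS-FREE WEDGE RANKS**: for any basis `β` of any `V` and any `x ∈ ⋀V`, the rank of `θ ↦ θ ∧ x` on `⋀^k V` is the MODEL
wedge rank (`Wedge.Kunneth.wedge`) of the coordinate expression `mapEquiv β.equivFun x ∈ ⋀(I → K)` — so every kernel theorem of the
coordinate model (THEOREM T, Künneth, the per-q laws, …) holds verbatim for classes written in an arbitrary basis. -/
theorem finrank_range_wedgeV_eq_model (β : Basis I K V) (k : ℕ) (x : ExteriorAlgebra K V) :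
    finrank K (LinearMap.range (wedgeV K k x)) = finrank K (LinearMap.range (wedge K I k (mapEquiv K β.equivFun x))) := by
  rw [← finrank_range_wedgeV_mapEquiv K β.equivFun k x]
  rfl

end Model

/-! ## §3. THEOREM T, coordinate-free -/

/-- **THEOREM T in an arbitrary basis**: `V` any `K`-space with a basis `β` indexed by `Fin (n+n)`, `n ≥ 1`, `a, c ≠ 0`; the pair
`f = a·β_{X} + c·β_{Y}` (`β_X = β₀ ∧ ⋯ ∧ β_{n−1}`, `β_Y = β_n ∧ ⋯ ∧ β_{2n−1}`) has `rank(θ ↦ θ ∧ f ∣ ⋀^k V) = 2C(n,k) − [k=0] − [k=n]`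
for every `k ≤ n` (`WedgePair.pointPairRank`; THEOREM T transported by `mapEquiv β.equivFun`). -/
theorem theoremT_basis {n : ℕ} (hn : 1 ≤ n) (β : Basis (Fin (n + n)) K V) {a c : K} (ha : a ≠ 0) (hc : c ≠ 0) {k : ℕ}
    (hk : k ≤ n) :
    finrank K (LinearMap.range (wedgeV K k
      (a • β.ExteriorAlgebra (WedgePair.Xset n) + c • β.ExteriorAlgebra (WedgePair.Yset n)))) = WedgePair.pointPairRank n k := by
  rw [finrank_range_wedgeV_eq_model K β, map_add, map_smul, map_smul, mapEquiv_equivFun_basis, mapEquiv_equivFun_basis]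
  exact WedgePair.finrank_range_wedgeMap_pointPair K (by omega) hk ha hc

/-- … and rank `0` for `k > n` (a `k`-set of more than `n` letters meets both halves). -/
theorem theoremT_basis_eq_zero {n : ℕ} (β : Basis (Fin (n + n)) K V) (a c : K) {k : ℕ} (hk : n < k) :
    finrank K (LinearMap.range (wedgeV K k
      (a • β.ExteriorAlgebra (WedgePair.Xset n) + c • β.ExteriorAlgebra (WedgePair.Yset n)))) = 0 := by
  rw [finrank_range_wedgeV_eq_model K β, map_add, map_smul, map_smul, mapEquiv_equivFun_basis, mapEquiv_equivFun_basis,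
    show wedge K (Fin (n + n)) k (a • B K (Fin (n + n)) (WedgePair.Xset n) + c • B K (Fin (n + n)) (WedgePair.Yset n)) =
      wedge K (Fin (n + n)) k (PairPowers.pp K n a c) from rfl, PairPowers.range_wedge_pp_eq_bot K hk, finrank_bot]

section Subspaces

variable {n : ℕ} {K₁ K₂ : Submodule K V}

/-- the basis of `V = K₁ ⊕ K₂` adapted to two COMPLEMENTARY subspaces with bases `b₁`, `b₂` (indexed by `Fin n` each): first the
`b₁`, then the `b₂` (th-6's «`N_X = K₁ ⊕ K₂`», th-7's blocks `X ⊔ Y`). -/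
noncomputable def basisOfIsCompl (h : IsCompl K₁ K₂) (b₁ : Basis (Fin n) K K₁) (b₂ : Basis (Fin n) K K₂) :
    Basis (Fin (n + n)) K V :=
  ((b₁.prod b₂).map (Submodule.prodEquivOfIsCompl K₁ K₂ h)).reindex finSumFinEquiv

/-- the first half of the adapted basis is `b₁`. -/
lemma basisOfIsCompl_castAdd (h : IsCompl K₁ K₂) (b₁ : Basis (Fin n) K K₁) (b₂ : Basis (Fin n) K K₂) (i : Fin n) :
    basisOfIsCompl K h b₁ b₂ (Fin.castAdd n i) = (b₁ i : V) := by
  rw [basisOfIsCompl, Basis.reindex_apply, finSumFinEquiv_symm_apply_castAdd, Basis.map_apply, Basis.prod_apply,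
    Submodule.coe_prodEquivOfIsCompl']
  simp

/-- the second half of the adapted basis is `b₂`. -/
lemma basisOfIsCompl_natAdd (h : IsCompl K₁ K₂) (b₁ : Basis (Fin n) K K₁) (b₂ : Basis (Fin n) K K₂) (i : Fin n) :
    basisOfIsCompl K h b₁ b₂ (Fin.natAdd n i) = (b₂ i : V) := by
  rw [basisOfIsCompl, Basis.reindex_apply, finSumFinEquiv_symm_apply_natAdd, Basis.map_apply, Basis.prod_apply,
    Submodule.coe_prodEquivOfIsCompl']
  simp

/-- the increasing enumeration of th-7's block `X = {0, …, n−1} ⊂ Fin (n+n)` is `Fin.castAdd n`. -/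
lemma enum_Xset : (⇑(ofFinEmbEquiv.symm (ofCard (WedgePair.card_Xset n))) : Fin n → Fin (n + n)) = Fin.castAdd n := by
  rw [ofFinEmbEquiv_symm_apply]
  exact (Finset.orderEmbOfFin_unique (WedgePair.card_Xset n) (f := Fin.castAdd n)
    (fun x => WedgePair.mem_Xset n |>.mpr (by simp)) (Fin.strictMono_castAdd n)).symm

/-- the increasing enumeration of th-7's block `Y = {n, …, 2n−1} ⊂ Fin (n+n)` is `Fin.natAdd n`. -/
lemma enum_Yset : (⇑(ofFinEmbEquiv.symm (ofCard (WedgePair.card_Yset n))) : Fin n → Fin (n + n)) = Fin.natAdd n := by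
  rw [ofFinEmbEquiv_symm_apply]
  exact (Finset.orderEmbOfFin_unique (WedgePair.card_Yset n) (f := Fin.natAdd n)
    (fun x => WedgePair.mem_Yset n |>.mpr (by simp)) (Fin.strictMono_natAdd n)).symm

/-- **the `X`-monomial of the adapted basis IS `vol(K₁) = b₁0 ∧ ⋯ ∧ b₁(n−1)`**. -/
theorem basisOfIsCompl_vol₁ (h : IsCompl K₁ K₂) (b₁ : Basis (Fin n) K K₁) (b₂ : Basis (Fin n) K K₂) :
    (basisOfIsCompl K h b₁ b₂).ExteriorAlgebra (WedgePair.Xset n) = ExteriorAlgebra.ιMulti K n (fun i => (b₁ i : V)) := by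
  rw [ExteriorAlgebra.basis_apply_ofCard _ (WedgePair.card_Xset n)]
  show ExteriorAlgebra.ιMulti K n (_ ∘ _) = _
  rw [enum_Xset]
  congr 1
  funext i
  exact basisOfIsCompl_castAdd K h b₁ b₂ i

/-- **the `Y`-monomial of the adapted basis IS `vol(K₂) = b₂0 ∧ ⋯ ∧ b₂(n−1)`**. -/
theorem basisOfIsCompl_vol₂ (h : IsCompl K₁ K₂) (b₁ : Basis (Fin n) K K₁) (b₂ : Basis (Fin n) K K₂) :
    (basisOfIsCompl K h b₁ b₂).ExteriorAlgebra (WedgePair.Yset n) = ExteriorAlgebra.ιMulti K n (fun i => (b₂ i : V)) := by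
  rw [ExteriorAlgebra.basis_apply_ofCard _ (WedgePair.card_Yset n)]
  show ExteriorAlgebra.ιMulti K n (_ ∘ _) = _
  rw [enum_Yset]
  congr 1
  funext i
  exact basisOfIsCompl_natAdd K h b₁ b₂ i

/-- **THEOREM T, COORDINATE-FREE (FORMULA-N PART A §2.2 as worded)**: `V` any `K`-space, `K₁ ⊕ K₂ = V` ANY two complementary
subspaces of dimension `n ≥ 1` with ANY bases `b₁`, `b₂`; `vol(K_j) := b_j0 ∧ ⋯ ∧ b_j(n−1)`; `a, c ≠ 0`.  Then the transverse pair
`f = a·vol(K₁) + c·vol(K₂)` has **`rank(θ ↦ θ ∧ f ∣ ⋀^k V) = r_k(n) = 2C(n,k) − [k=0] − [k=n]`** for every `k ≤ n` — th-6: «pure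
exterior algebra; the complex structure enters only through `dim V = n`». -/
theorem theoremT_subspaces (hn : 1 ≤ n) (h : IsCompl K₁ K₂) (b₁ : Basis (Fin n) K K₁) (b₂ : Basis (Fin n) K K₂) {a c : K}
    (ha : a ≠ 0) (hc : c ≠ 0) {k : ℕ} (hk : k ≤ n) :
    finrank K (LinearMap.range (wedgeV K k
      (a • ExteriorAlgebra.ιMulti K n (fun i => (b₁ i : V)) + c • ExteriorAlgebra.ιMulti K n (fun i => (b₂ i : V))))) =
      WedgePair.pointPairRank n k := by
  rw [← basisOfIsCompl_vol₁ K h b₁ b₂, ← basisOfIsCompl_vol₂ K h b₁ b₂]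
  exact theoremT_basis K hn _ ha hc hk

/-- … and `0` for `k > n`. -/
theorem theoremT_subspaces_eq_zero (h : IsCompl K₁ K₂) (b₁ : Basis (Fin n) K K₁) (b₂ : Basis (Fin n) K K₂) (a c : K) {k : ℕ}
    (hk : n < k) :
    finrank K (LinearMap.range (wedgeV K k
      (a • ExteriorAlgebra.ιMulti K n (fun i => (b₁ i : V)) + c • ExteriorAlgebra.ιMulti K n (fun i => (b₂ i : V))))) = 0 := by
  rw [← basisOfIsCompl_vol₁ K h b₁ b₂, ← basisOfIsCompl_vol₂ K h b₁ b₂]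
  exact theoremT_basis_eq_zero K _ a c hk

end Subspaces

end Summit.Ventures.HSemireg.Wedge.BasisFree
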